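import Mathlib
import HarnessLib
import Literature.MathematicalPhysics.KineticTheory.VelocityFlipNoise

/-!
# Momentum-parity toolkit, II: independence of a momentum, flip parity of partial derivatives
# (line `abel-storage-decay`, crux `VanishingNoiseTransfer.NoisyFourier`, stmt-AtomisticToContinuum-11977, stub B
# `stub_bulkAbelGKPositivity`; part W2 "FlipParity" of the Thomson-witness project of lead c7)

`--supports stmt-AtomisticToContinuum-11977` file (independent of parts I and III, `…ThomsonWitnessParity`,
`…ThomsonWitnessParityAux2`). Notation: `F_m = momentumFlip m` (`p_m ↦ -p_m`) on `PhaseSpace L`; "`g` is independent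
of `p_m`" means `∀ x t, g (x.1, x.2[m ↦ t]) = g x`; `partialQ l`/`partialP l` are the coordinate derivatives
`∂_{q_l}`, `∂_{p_l}` (one-variable `deriv`s of slices, junk `0` where not differentiable — every statement below is an
identity of such `deriv`s of pointwise-equal or reflected slices, so NO differentiability is assumed).

* independence API: `indep_fst_apply`, `indep_snd_of_ne`, `indep_add/_sub/_mul/_neg/_const_mul/_comp/_finset_sum/
  _finset_prod`; `partialP_eq_zero_of_indep` (`∂_{p_m} g = 0`), `indep_partialQ`, `indep_partialP` (independence of
  `p_m` passes to `∂_{q_l} g` and to `∂_{p_l} g`, `l ≠ m`).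
* parity of partial derivatives: `partialQ_comp_momentumFlip`, `partialP_comp_momentumFlip_self/_of_ne`,
  `partialQ_momentumFlip_of_even/_of_odd`,
  `partialP_momentumFlip_of_even_self/_of_even_of_ne/_of_odd_self/_of_odd_of_ne`
  (`∂_q` preserves `F_m`-parity, `∂_{p_l}` preserves it for `l ≠ m`, `∂_{p_m}` swaps it).
* the force `∂_{q_l} H` depends on the positions only: `partialQ_hamiltonian_mk_fst/_momentumFlip/_update_snd/_pattern`;
  the `l`-th Liouvillian term `p_l ∂_{q_l} g − ∂_{q_l}H ∂_{p_l} g` of an `F_m`-even `g` is `F_l`-odd (`m = l`) and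
  `F_m`-even (`m ≠ l`): `liouvilleTerm_momentumFlip_self/_of_ne`; odd versions `…_self_of_odd/_of_ne_of_odd`.
* `helper_partialPMomentumFlipOfEvenSelf` — registered notation-free restatement of `partialP_momentumFlip_of_even_self`.

References: folklore. No definitions; axioms `propext`, `Classical.choice`, `Quot.sound` only.
-/

noncomputable section

open MeasureTheory
open scoped BigOperators
open Literature.MathematicalPhysics.KineticTheory.HeatConduction

namespace Summit.AtomisticToContinuum.FouriersLaw.Theorems.NoisyFourier.ThomsonWitness.Parity

variable {L : ℕ}

/-! ## Independence of a momentum: closure properties and partial derivatives -/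

section Indep

variable {m : Fin L} {f g : PhaseSpace L → ℝ}

/-- A function of the positions is independent of every momentum. [folklore] -/
theorem indep_fst_apply (m : Fin L) (φ : (Fin L → ℝ) → ℝ) (x : PhaseSpace L) (t : ℝ) :
    φ ((x.1, Function.update x.2 m t) : PhaseSpace L).1 = φ x.1 := rfl

/-- The momentum `p_k` is independent of `p_m` for `k ≠ m`. [folklore] -/
theorem indep_snd_of_ne {m k : Fin L} (hkm : k ≠ m) (x : PhaseSpace L) (t : ℝ) :
    ((x.1, Function.update x.2 m t) : PhaseSpace L).2 k = x.2 k :=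
  Function.update_of_ne hkm t x.2

/-- Independence of `p_m` is closed under sums. [folklore] -/
theorem indep_add (hf : ∀ (x : PhaseSpace L) (t : ℝ), f (x.1, Function.update x.2 m t) = f x)
    (hg : ∀ (x : PhaseSpace L) (t : ℝ), g (x.1, Function.update x.2 m t) = g x) (x : PhaseSpace L) (t : ℝ) :
    f (x.1, Function.update x.2 m t) + g (x.1, Function.update x.2 m t) = f x + g x := by
  rw [hf, hg]

/-- Independence of `p_m` is closed under differences. [folklore] -/
theorem indep_sub (hf : ∀ (x : PhaseSpace L) (t : ℝ), f (x.1, Function.update x.2 m t) = f x)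
    (hg : ∀ (x : PhaseSpace L) (t : ℝ), g (x.1, Function.update x.2 m t) = g x) (x : PhaseSpace L) (t : ℝ) :
    f (x.1, Function.update x.2 m t) - g (x.1, Function.update x.2 m t) = f x - g x := by
  rw [hf, hg]

/-- Independence of `p_m` is closed under products. [folklore] -/
theorem indep_mul (hf : ∀ (x : PhaseSpace L) (t : ℝ), f (x.1, Function.update x.2 m t) = f x)
    (hg : ∀ (x : PhaseSpace L) (t : ℝ), g (x.1, Function.update x.2 m t) = g x) (x : PhaseSpace L) (t : ℝ) :
    f (x.1, Function.update x.2 m t) * g (x.1, Function.update x.2 m t) = f x * g x := by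
  rw [hf, hg]

/-- Independence of `p_m` is closed under negation. [folklore] -/
theorem indep_neg (hf : ∀ (x : PhaseSpace L) (t : ℝ), f (x.1, Function.update x.2 m t) = f x)
    (x : PhaseSpace L) (t : ℝ) : -f (x.1, Function.update x.2 m t) = -f x := by
  rw [hf]

/-- Independence of `p_m` is closed under scalar multiples. [folklore] -/
theorem indep_const_mul (c : ℝ) (hf : ∀ (x : PhaseSpace L) (t : ℝ), f (x.1, Function.update x.2 m t) = f x)
    (x : PhaseSpace L) (t : ℝ) : c * f (x.1, Function.update x.2 m t) = c * f x := by
  rw [hf]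

/-- Independence of `p_m` is closed under post-composition with a real function. [folklore] -/
theorem indep_comp (φ : ℝ → ℝ) (hf : ∀ (x : PhaseSpace L) (t : ℝ), f (x.1, Function.update x.2 m t) = f x)
    (x : PhaseSpace L) (t : ℝ) : φ (f (x.1, Function.update x.2 m t)) = φ (f x) := by
  rw [hf]

/-- Independence of `p_m` is closed under finite sums. [folklore] -/
theorem indep_finset_sum {ι : Type*} (s : Finset ι) {f : ι → PhaseSpace L → ℝ}
    (hf : ∀ k ∈ s, ∀ (x : PhaseSpace L) (t : ℝ), f k (x.1, Function.update x.2 m t) = f k x)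
    (x : PhaseSpace L) (t : ℝ) : ∑ k ∈ s, f k (x.1, Function.update x.2 m t) = ∑ k ∈ s, f k x :=
  Finset.sum_congr rfl fun k hk => hf k hk x t

/-- Independence of `p_m` is closed under finite products. [folklore] -/
theorem indep_finset_prod {ι : Type*} (s : Finset ι) {f : ι → PhaseSpace L → ℝ}
    (hf : ∀ k ∈ s, ∀ (x : PhaseSpace L) (t : ℝ), f k (x.1, Function.update x.2 m t) = f k x)
    (x : PhaseSpace L) (t : ℝ) : ∏ k ∈ s, f k (x.1, Function.update x.2 m t) = ∏ k ∈ s, f k x :=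
  Finset.prod_congr rfl fun k hk => hf k hk x t

/-- **A function independent of `p_m` has `∂_{p_m} g = 0`** (its `p_m`-slice is constant). [folklore] -/
theorem partialP_eq_zero_of_indep (hg : ∀ (x : PhaseSpace L) (t : ℝ), g (x.1, Function.update x.2 m t) = g x)
    (x : PhaseSpace L) : partialP m g x = 0 := by
  unfold partialP
  simp_rw [hg]
  exact deriv_const _ _

/-- If `g` is independent of `p_m` then so is every `∂_{q_l} g` (the slices agree pointwise; no
differentiability needed). [folklore] -/
theorem indep_partialQ (hg : ∀ (x : PhaseSpace L) (t : ℝ), g (x.1, Function.update x.2 m t) = g x)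
    (l : Fin L) (x : PhaseSpace L) (t : ℝ) :
    partialQ l g (x.1, Function.update x.2 m t) = partialQ l g x := by
  unfold partialQ
  dsimp only
  congr 1
  funext s
  exact hg (Function.update x.1 l s, x.2) t

/-- If `g` is independent of `p_m` then so is `∂_{p_l} g` for `l ≠ m` (`Function.update_comm`; no
differentiability needed). [folklore] -/
theorem indep_partialP (hg : ∀ (x : PhaseSpace L) (t : ℝ), g (x.1, Function.update x.2 m t) = g x)
    {l : Fin L} (hlm : l ≠ m) (x : PhaseSpace L) (t : ℝ) :
    partialP l g (x.1, Function.update x.2 m t) = partialP l g x := by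
  unfold partialP
  dsimp only
  rw [Function.update_of_ne hlm]
  congr 1
  funext s
  rw [Function.update_comm hlm.symm]
  exact hg (x.1, Function.update x.2 l s) t

end Indep

/-! ## Parity of partial derivatives under a momentum flip -/

section Partials

variable {m l : Fin L} {g : PhaseSpace L → ℝ}

-- the next three lemmas are adapted from `SketchIdeatorR2K4` §1a (crux VanishingNoiseBound)
/-- `∂_{q_l} (f ∘ F_m) = (∂_{q_l} f) ∘ F_m`. [folklore] -/
theorem partialQ_comp_momentumFlip (m l : Fin L) (f : PhaseSpace L → ℝ) (x : PhaseSpace L) :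
    partialQ l (f ∘ momentumFlip m) x = partialQ l f (momentumFlip m x) := by
  unfold partialQ
  rfl

/-- `∂_{p_m} (f ∘ F_m) = -(∂_{p_m} f) ∘ F_m` (chain rule for `t ↦ -t`, valid without differentiability).
[folklore] -/
theorem partialP_comp_momentumFlip_self (m : Fin L) (f : PhaseSpace L → ℝ) (x : PhaseSpace L) :
    partialP m (f ∘ momentumFlip m) x = -partialP m f (momentumFlip m x) := by
  unfold partialP
  set φ : ℝ → ℝ := fun s => f (x.1, Function.update x.2 m s) with hφ
  have h : (fun t => (f ∘ momentumFlip m) (x.1, Function.update x.2 m t)) = fun t => φ (-t) := by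
    funext t
    simp [hφ, momentumFlip, Function.update_idem]
  have h2 : (fun s => f ((momentumFlip m x).1, Function.update (momentumFlip m x).2 m s)) = φ := by
    funext s
    simp [hφ, momentumFlip, Function.update_idem]
  rw [h, h2, deriv_comp_neg]
  simp [momentumFlip]

/-- `∂_{p_l} (f ∘ F_m) = (∂_{p_l} f) ∘ F_m` for `l ≠ m`. [folklore] -/
theorem partialP_comp_momentumFlip_of_ne (hlm : l ≠ m) (f : PhaseSpace L → ℝ) (x : PhaseSpace L) :
    partialP l (f ∘ momentumFlip m) x = partialP l f (momentumFlip m x) := by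
  unfold partialP
  have h : (fun t => (f ∘ momentumFlip m) (x.1, Function.update x.2 l t)) =
      fun t => f ((momentumFlip m x).1, Function.update (momentumFlip m x).2 l t) := by
    funext t
    simp only [Function.comp_apply, momentumFlip]
    rw [Function.update_of_ne hlm.symm, Function.update_comm hlm]
  rw [h]
  simp [momentumFlip, Function.update_of_ne hlm]

/-- `∂_{q_l}` of an `F_m`-even function is `F_m`-even. [folklore] -/
theorem partialQ_momentumFlip_of_even (hg : ∀ x, g (momentumFlip m x) = g x) (l : Fin L) (x : PhaseSpace L) :
    partialQ l g (momentumFlip m x) = partialQ l g x := by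
  have hfun : g ∘ momentumFlip m = g := funext hg
  rw [← partialQ_comp_momentumFlip m l g x, hfun]

/-- `∂_{p_l}` (`l ≠ m`) of an `F_m`-even function is `F_m`-even. [folklore] -/
theorem partialP_momentumFlip_of_even_of_ne (hg : ∀ x, g (momentumFlip m x) = g x) (hlm : l ≠ m)
    (x : PhaseSpace L) : partialP l g (momentumFlip m x) = partialP l g x := by
  have hfun : g ∘ momentumFlip m = g := funext hg
  rw [← partialP_comp_momentumFlip_of_ne hlm g x, hfun]

/-- `∂_{p_m}` of an `F_m`-even function is `F_m`-odd. [folklore] -/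
theorem partialP_momentumFlip_of_even_self (hg : ∀ x, g (momentumFlip m x) = g x) (x : PhaseSpace L) :
    partialP m g (momentumFlip m x) = -partialP m g x := by
  have hfun : g ∘ momentumFlip m = g := funext hg
  have h := partialP_comp_momentumFlip_self m g x
  rw [hfun] at h
  linarith

/-- `∂_{q_l}` of an `F_m`-odd function is `F_m`-odd. [folklore] -/
theorem partialQ_momentumFlip_of_odd (hg : ∀ x, g (momentumFlip m x) = -g x) (l : Fin L) (x : PhaseSpace L) :
    partialQ l g (momentumFlip m x) = -partialQ l g x := by
  have hfun : g ∘ momentumFlip m = fun y => -g y := funext hg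
  rw [← partialQ_comp_momentumFlip m l g x, hfun]
  -- `∂_{q_l} (−g) = −∂_{q_l} g` unconditionally (`deriv.neg`; cf. `Kubo.partialP_neg`, `contact_partialQ_neg`)
  unfold partialQ
  exact deriv.neg

/-- `∂_{p_l}` (`l ≠ m`) of an `F_m`-odd function is `F_m`-odd. [folklore] -/
theorem partialP_momentumFlip_of_odd_of_ne (hg : ∀ x, g (momentumFlip m x) = -g x) (hlm : l ≠ m)
    (x : PhaseSpace L) : partialP l g (momentumFlip m x) = -partialP l g x := by
  have hfun : g ∘ momentumFlip m = fun y => -g y := funext hg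
  rw [← partialP_comp_momentumFlip_of_ne hlm g x, hfun]
  unfold partialP
  exact deriv.neg

/-- `∂_{p_m}` of an `F_m`-odd function is `F_m`-even. [folklore] -/
theorem partialP_momentumFlip_of_odd_self (hg : ∀ x, g (momentumFlip m x) = -g x) (x : PhaseSpace L) :
    partialP m g (momentumFlip m x) = partialP m g x := by
  have hfun : g ∘ momentumFlip m = fun y => -g y := funext hg
  have h := partialP_comp_momentumFlip_self m g x
  have hneg : partialP m (fun y => -g y) x = -partialP m g x := by
    unfold partialP
    exact deriv.neg
  rw [hfun, hneg] at h
  linarith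

/-! ### The force `∂_{q_l} H` depends on the positions only -/

/-- `∂_{q_l} H (q, p)` does not depend on `p`. [folklore] -/
theorem partialQ_hamiltonian_mk_fst (P : OscillatorChain) (l : Fin L) (x : PhaseSpace L) (p : Fin L → ℝ) :
    partialQ l (P.hamiltonian L) (x.1, p) = partialQ l (P.hamiltonian L) x := by
  rw [P.partialQ_hamiltonian_eq, P.partialQ_hamiltonian_eq]

/-- `∂_{q_l} H` is even under every momentum flip. [folklore] -/
theorem partialQ_hamiltonian_momentumFlip (P : OscillatorChain) (l m : Fin L) (x : PhaseSpace L) :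
    partialQ l (P.hamiltonian L) (momentumFlip m x) = partialQ l (P.hamiltonian L) x :=
  partialQ_hamiltonian_mk_fst P l x _

/-- `∂_{q_l} H` is independent of every momentum. [folklore] -/
theorem partialQ_hamiltonian_update_snd (P : OscillatorChain) (l m : Fin L) (x : PhaseSpace L) (t : ℝ) :
    partialQ l (P.hamiltonian L) (x.1, Function.update x.2 m t) = partialQ l (P.hamiltonian L) x :=
  partialQ_hamiltonian_mk_fst P l x _

/-- `∂_{q_l} H` is invariant under every momentum sign pattern. [folklore] -/
theorem partialQ_hamiltonian_pattern (P : OscillatorChain) (l : Fin L) (w : Fin L → Bool) (x : PhaseSpace L) :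
    partialQ l (P.hamiltonian L) (x.1, fun i => if w i then -x.2 i else x.2 i) = partialQ l (P.hamiltonian L) x :=
  partialQ_hamiltonian_mk_fst P l x _

/-! ### Parity of the Liouvillian terms `p_l ∂_{q_l} g − ∂_{q_l}H ∂_{p_l} g` -/

/-- The `l`-th Liouvillian term of an `F_l`-even `g` is `F_l`-odd. [folklore] -/
theorem liouvilleTerm_momentumFlip_self (P : OscillatorChain) (hg : ∀ x, g (momentumFlip l x) = g x)
    (x : PhaseSpace L) :
    (momentumFlip l x).2 l * partialQ l g (momentumFlip l x) -
        partialQ l (P.hamiltonian L) (momentumFlip l x) * partialP l g (momentumFlip l x) =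
      -(x.2 l * partialQ l g x - partialQ l (P.hamiltonian L) x * partialP l g x) := by
  rw [momentumFlip_snd_self, partialQ_momentumFlip_of_even hg, partialQ_hamiltonian_momentumFlip,
    partialP_momentumFlip_of_even_self hg]
  ring

/-- The `l`-th Liouvillian term of an `F_m`-even `g`, `m ≠ l`, is `F_m`-even. [folklore] -/
theorem liouvilleTerm_momentumFlip_of_ne (P : OscillatorChain) (hlm : l ≠ m) (hg : ∀ x, g (momentumFlip m x) = g x)
    (x : PhaseSpace L) :
    (momentumFlip m x).2 l * partialQ l g (momentumFlip m x) -
        partialQ l (P.hamiltonian L) (momentumFlip m x) * partialP l g (momentumFlip m x) =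
      x.2 l * partialQ l g x - partialQ l (P.hamiltonian L) x * partialP l g x := by
  rw [momentumFlip_snd_of_ne hlm, partialQ_momentumFlip_of_even hg, partialQ_hamiltonian_momentumFlip,
    partialP_momentumFlip_of_even_of_ne hg hlm]

/-- The `l`-th Liouvillian term of an `F_l`-odd `g` is `F_l`-even. [folklore] -/
theorem liouvilleTerm_momentumFlip_self_of_odd (P : OscillatorChain) (hg : ∀ x, g (momentumFlip l x) = -g x)
    (x : PhaseSpace L) :
    (momentumFlip l x).2 l * partialQ l g (momentumFlip l x) -
        partialQ l (P.hamiltonian L) (momentumFlip l x) * partialP l g (momentumFlip l x) =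
      x.2 l * partialQ l g x - partialQ l (P.hamiltonian L) x * partialP l g x := by
  rw [momentumFlip_snd_self, partialQ_momentumFlip_of_odd hg, partialQ_hamiltonian_momentumFlip,
    partialP_momentumFlip_of_odd_self hg]
  ring

/-- The `l`-th Liouvillian term of an `F_m`-odd `g`, `m ≠ l`, is `F_m`-odd. [folklore] -/
theorem liouvilleTerm_momentumFlip_of_ne_of_odd (P : OscillatorChain) (hlm : l ≠ m)
    (hg : ∀ x, g (momentumFlip m x) = -g x) (x : PhaseSpace L) :
    (momentumFlip m x).2 l * partialQ l g (momentumFlip m x) -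
        partialQ l (P.hamiltonian L) (momentumFlip m x) * partialP l g (momentumFlip m x) =
      -(x.2 l * partialQ l g x - partialQ l (P.hamiltonian L) x * partialP l g x) := by
  rw [momentumFlip_snd_of_ne hlm, partialQ_momentumFlip_of_odd hg, partialQ_hamiltonian_momentumFlip,
    partialP_momentumFlip_of_odd_of_ne hg hlm]
  ring

end Partials

/-! ## Registered helper (notation-free restatement) -/

/-- Registered helper sub-goal `helper_partialPMomentumFlipOfEvenSelf` of crux stmt-AtomisticToContinuum-11977 (line
`abel-storage-decay`, stub B `stub_bulkAbelGKPositivity`, part W2): `∂_{p_m}` of an `F_m`-even function is `F_m`-odd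
(`partialP_momentumFlip_of_even_self`, restated). [folklore] -/
theorem helper_partialPMomentumFlipOfEvenSelf : ∀ (L : ℕ) (m : Fin L) (g : Literature.MathematicalPhysics.KineticTheory.HeatConduction.PhaseSpace L → ℝ), (∀ x : Literature.MathematicalPhysics.KineticTheory.HeatConduction.PhaseSpace L, g (Literature.MathematicalPhysics.KineticTheory.HeatConduction.momentumFlip m x) = g x) → ∀ x : Literature.MathematicalPhysics.KineticTheory.HeatConduction.PhaseSpace L, Literature.MathematicalPhysics.KineticTheory.HeatConduction.partialP m g (Literature.MathematicalPhysics.KineticTheory.HeatConduction.momentumFlip m x) = -Literature.MathematicalPhysics.KineticTheory.HeatConduction.partialP m g x :=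
  fun _ _ _ hg x => partialP_momentumFlip_of_even_self hg x

end Summit.AtomisticToContinuum.FouriersLaw.Theorems.NoisyFourier.ThomsonWitness.Parity

end
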